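import Summits.Langlands.Langlands.Theses.RamifiedCoefficientSeed
import Summits.Langlands.Langlands.Theorems.IrreducibilityBySelfDualityIrreducibleOffSectorOfReciprocity
import Literature.NumberTheory.Automorphic.ChebotarevArtinRepHolds
import Literature.NumberTheory.GaloisRepresentations.FramedRepEquivConj
import Literature.NumberTheory.GaloisRepresentations.AbsIrreducibleIndexTwo
import Literature.NumberTheory.Automorphic.BCDTModularity
import HarnessLib

/-!
# `RamifiedCoefficientSeed.SectorComplement` is sandwiched by the item `ReciprocityUpToIrreducibilityR`
(stmt-Langlands-17925) granted Arthur–Clozel (2.2)–(2.3) — item-level certificate and logical position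
(crux stmt-Langlands-16781, line lead prover-line-stmt-Langlands-16781-0, 2026-08-17; `--supports` file:
no `sorry`, no new definition, axioms `propext` / `Classical.choice` / `Quot.sound`)

`SectorComplement := NonPolarisableFamilyAutomorphic → _root_.Langlands` is the declared OUT-OF-SCOPE
REMAINDER (frame item, rank 5, "never staffed from this route") of route `RamifiedCoefficientSeed`: the rest
of `GL_n` reciprocity beyond the route's explicit non-polarisable rank-3 family over `ℚ`.  This file records,
on the texts of EXISTING items, where the junction's open content lives after the 2026-08-17 re-type of the
summit (`∀ F, Nonempty (ReciprocityData F) ∧ ∀ 𝓡 n hcpt, (A) ∧ (B)`):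

* R  := the text of item stmt-Langlands-17925 `IrreducibilityBySelfDuality.ReciprocityUpToIrreducibilityR`
  (reciprocity up to irreducibility for EVERY pinned reciprocity datum, with the non-vacuity conjunct: the
  summit minus irreducibility and uniqueness-up-to-conjugacy in clause (A)); written out verbatim because the
  decl lives in another route's Theses module whose farm olean predates it;
* JS := the Literature named facts `JacquetShalika1981_partialPairL_boundary_repData` (Arthur–Clozel Ch. 3
  (2.2); VERBATIM item stmt-Langlands-13622 `PairLBoundaryJS`) and `JacquetShalika1981_partialPairL_pole_repData`
  ((2.3); VERBATIM item stmt-Langlands-19093 `PairLPoleJS`) — the two registered stubs `stub_pairLBoundaryJS`,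
  `stub_pairLPoleJS` of this crux's skeleton `Lines/birth_RamifiedCoefficientSeed.lean` (sha d02cc421).

Theorems:
* `langlands_of_reciprocityUpToIrreducibilityR_text_of_JS` — JS (2.2) → JS (2.3) → R → `Langlands`: for each
  `𝓡`, clause (B) is R's; the avatar of clause (A) — and every a.e.-compatible `ρ'` — is irreducible by the
  landed isobaric bootstrap `IrreducibleOffSector.isIrreducible_of_reciprocityUpToIrreducibility` (p103935),
  hence semisimple; two corresponding avatars have equal Satake parameters a.e.
  (`hasSatakeParamAt_unique_holds`), so equal Frobenius polynomials a.e., so are equivalent (Chebotarev +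
  Brauer–Nesbitt, `FramedGaloisRep.nonempty_equiv_of_hasFrobCharpolyAt_eventually`), so conjugate
  (`FramedRep.exists_eq_conj_of_equiv`).  RE-ELABORATES verbatim the landed seam
  `SectorComplementSeam.langlands_of_reciprocityUpToIrreducibility_forall_text_of_JS` (p147356,
  `Theorems/EisensteinGelfandKirillovSectorComplementSeam.lean`) and its twin
  `PhantomRMYoshidaJunctionOfR.langlands_of_reciprocityUpToIrreducibilityR_text_of_JS`
  (`Theorems/PhantomRMYoshidaPhantomRMJunctionOfR.lean`), both of whose modules the farm serves unbuilt at
  the time of writing — switch to an import when they are built;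
* `sectorComplement_of_reciprocityUpToIrreducibilityR_text_of_JS` — SUFFICIENCY: JS ∧ R ⇒ the crux (the
  sector hypothesis is discarded);
* `reciprocityUpToIrreducibilityR_text_of_langlands` — R is a weakening of the summit (unconditional);
* `reciprocityUpToIrreducibilityR_text_of_sectorComplement_of_target` / `…_of_cruxes` — NECESSITY under the
  route target `NonPolarisableFamilyAutomorphic`, resp. under the three ranked cruxes `ExplicitRamifiedFamily`,
  `AdjointSeedFromDuality`, `AdjointLiftingGL3` (through the route's own deciding theorem `closes`): the crux
  gives the summit, hence R — the crux cannot close before stmt-Langlands-17925 once the target holds;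
* `sectorComplement_iff_reciprocityUpToIrreducibilityR_text` — under JS and the target, crux ↔ R;
* logical position (re-derivation, for the Theorems tree, of the strategist's crux-store file
  `Cruxes/SectorComplement/Position_RamifiedCoefficientSeed.lean`, cstrat q1, 2026-08-17):
  `sectorComplement_iff_langlands_of_target` (X → (C ↔ Langlands)), `sectorComplement_iff_langlands_of_cruxes`,
  `not_sectorComplement_iff` (¬ C ↔ X ∧ ¬ Langlands: a refutation of the crux is a proof of the open sector
  theorem together with a refutation of the audited summit; `¬ C → ¬ Langlands` itself is the sibling frame's
  `skinnerWilesDefectOne_not_langlands_of_not_sectorComplement` up to the route namespace and is not restated),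
  `sectorComplement_iff_not_or` (truth table),
  `weakB_rank3_of_langlands` (direction (B) of the summit at `n = 3`, `F = ℚ`, weak form) and
  `langlands_iff_target_and_sectorComplement_of_family` (given the explicit family ALONE,
  `Langlands ↔ X ∧ C`; `Langlands → X` without the family is not formal, X being existential).

Nothing here asserts the crux, the target, R, JS or the summit.

References: K. Buzzard, T. Gee, LMS LNS 414 (2014), Conj. 3.2.1–3.2.2 [BuzzardGeeLMS2014]; J.-M. Fontaine,
B. Mazur (1995), Conj. 1 [FontaineMazurGeometric1995]; J. Arthur, L. Clozel, Ann. Math. Stud. 120, Ch. 3 §2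
(2.2)–(2.3) [ArthurClozelAMS120]; F. Calegari, T. Gee, Ann. Inst. Fourier 63 (2013) §1.1 [CalegariGee2013];
P. Deligne, J.-P. Serre, ASENS 7 (1974), Lemme 3.2 [DeligneSerreASENS1974]; H. Darmon, F. Diamond, R. Taylor
(1995) §2.1 [DarmonDiamondTaylor1995].
-/

noncomputable section

set_option linter.dupNamespace false -- project-wide option; `Summit.Langlands.Langlands` is the mandated namespace

open scoped NumberField
open Filter IsDedekindDomain
open Literature.NumberTheory.Automorphic Literature.NumberTheory.GaloisRepresentations
open Summit.Langlands
open Summit.Langlands.Langlands.Theses.RamifiedCoefficientSeed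
open Summit.Langlands.Langlands.Theorems.IrreducibleOffSector

namespace Summit.Langlands.Langlands.Theorems.RamifiedCoefficientSeedJunctionOfR

/-! ## §1 Sufficiency: JS (2.2) → JS (2.3) → R → `Langlands` → the crux -/

/-- **`Langlands` (re-typed, `∀ 𝓡`) from the text R of item stmt-Langlands-17925 and Arthur–Clozel
(2.2)–(2.3) for Borel–Jacquet data** (Literature named facts = items stmt-Langlands-13622 /
stmt-Langlands-19093 verbatim).  For each `𝓡`: clause (B) is R's; clause (A)'s avatar — and every
a.e.-compatible `ρ'` — is irreducible by the isobaric bootstrap, hence semisimple, and two corresponding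
avatars have equal Satake parameters a.e., so equal Frobenius polynomials a.e., so are equivalent
(Chebotarev + Brauer–Nesbitt), so conjugate.  Re-elaborates the landed seam
`SectorComplementSeam.langlands_of_reciprocityUpToIrreducibility_forall_text_of_JS` (p147356) on these texts.
[cite: CalegariGee2013, §1.1] [cite: BuzzardGeeLMS2014, Conj. 3.2.1 and Conj. 3.2.2]
[cite: DeligneSerreASENS1974, Lemme 3.2] -/
theorem langlands_of_reciprocityUpToIrreducibilityR_text_of_JS
    (h22 : JacquetShalika1981_partialPairL_boundary_repData)
    (h23 : JacquetShalika1981_partialPairL_pole_repData)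
    (hR : ∀ (F : Type) [Field F] [NumberField F], Nonempty (ReciprocityData F) ∧
      ∀ (Rec : ReciprocityData F) (n : ℕ), 0 < n →
        ∀ hcpt : Literature.NumberTheory.Automorphic.isCompact_glFiniteIntegralLevel n F,
          (∀ π : Literature.NumberTheory.Automorphic.CuspidalAutomorphicRepData n F hcpt, π.1.IsLAlgebraic →
            ∀ (ℓ : ℕ) [Fact ℓ.Prime] (ι : PadicAlgCl ℓ ≃+* ℂ),
              ∃ ρ : Literature.NumberTheory.GaloisRepresentations.FramedGaloisRep F (PadicAlgCl ℓ) n,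
                IsGeometricFramed Rec ρ ∧ Corresponds Rec ι π.1 ρ) ∧ GaloisToAutomorphic n Rec hcpt) :
    _root_.Langlands := by
  -- adapted from Theorems/PhantomRMYoshidaPhantomRMJunctionOfR.lean (module unbuilt on the farm)
  intro F _ _
  refine ⟨(hR F).1, fun Rec n hn hcpt => ?_⟩
  have hRec := fun n hn hcpt => (hR F).2 Rec n hn hcpt
  obtain ⟨hA, hB⟩ := (hR F).2 Rec n hn hcpt
  refine ⟨?_, hB⟩
  intro π hL ℓ _ ι
  -- irreducibility of EVERY avatar Satake–Frobenius compatible a.e. with `π`: the isobaric bootstrap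
  have irr : ∀ ρ : FramedGaloisRep F (PadicAlgCl ℓ) n,
      (∀ᶠ v : HeightOneSpectrum (𝓞 F) in cofinite, SatakeFrobCompatibleAt ι π.1 ρ v) →
        ρ.toGaloisRep.IsIrreducible :=
    fun ρ hρ => isIrreducible_of_reciprocityUpToIrreducibility h22 h23 hRec hcpt hn π hL ι ρ hρ
  obtain ⟨ρ, hgeo, hcorr⟩ := hA π hL ℓ ι
  refine ⟨ρ, irr ρ hcorr.1, hgeo, hcorr, fun ρ' hcorr' => ?_⟩
  -- uniqueness up to conjugacy: irreducible ⇒ semisimple; equal Satake parameters a.e. (Flath)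
  -- ⇒ equal Frobenius polynomials a.e. ⇒ equivalent (Chebotarev + Brauer–Nesbitt) ⇒ conjugate
  have h1 : ρ.toGaloisRep.IsIrreducible := irr ρ hcorr.1
  have h2 : ρ'.toGaloisRep.IsIrreducible := irr ρ' hcorr'.1
  have hs1 : ρ.toGaloisRep.IsSemisimple := by
    haveI := h1
    change ComplementedLattice _
    infer_instance
  have hs2 : ρ'.toGaloisRep.IsSemisimple := by
    haveI := h2
    change ComplementedLattice _
    infer_instance
  have hev : ∀ᶠ v : HeightOneSpectrum (𝓞 F) in cofinite,
      ρ.IsUnramifiedAt v ∧ ρ'.IsUnramifiedAt v ∧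
        ∃ P : Polynomial (PadicAlgCl ℓ), ρ.HasFrobCharpolyAt v P ∧ ρ'.HasFrobCharpolyAt v P := by
    filter_upwards [hcorr.1, hcorr'.1] with v hv hv'
    obtain ⟨α, hα, hur, hcp⟩ := hv
    obtain ⟨α', hα', hur', hcp'⟩ := hv'
    obtain rfl : α = α' := AutomorphicRepData.hasSatakeParamAt_unique_holds π.1 hα hα'
    exact ⟨hur, hur', _, hcp, hcp'⟩
  obtain ⟨e⟩ := FramedGaloisRep.nonempty_equiv_of_hasFrobCharpolyAt_eventually
    chebotarev_artinRep_holds ρ ρ' hs1 hs2 hev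
  obtain ⟨P, hP⟩ := FramedRep.exists_eq_conj_of_equiv ρ ρ' e
  exact ⟨P, hP.symm⟩

/-- **SUFFICIENCY — the crux from R and JS (2.2)–(2.3)**: `RamifiedCoefficientSeed.SectorComplement`
follows from the texts of items stmt-Langlands-17925, stmt-Langlands-13622, stmt-Langlands-19093 (the sector
hypothesis `NonPolarisableFamilyAutomorphic` is discarded).
[cite: BuzzardGeeLMS2014, Conj. 3.2.1 and Conj. 3.2.2] [cite: ArthurClozelAMS120, Ch. 3 §2 (2.2)–(2.3)] -/
theorem sectorComplement_of_reciprocityUpToIrreducibilityR_text_of_JS : Literature.NumberTheory.Automorphic.JacquetShalika1981_partialPairL_boundary_repData → Literature.NumberTheory.Automorphic.JacquetShalika1981_partialPairL_pole_repData → (∀ (F : Type) [Field F] [NumberField F], Nonempty (Summit.Langlands.ReciprocityData F) ∧ ∀ (Rec : Summit.Langlands.ReciprocityData F) (n : ℕ), 0 < n → ∀ hcpt : Literature.NumberTheory.Automorphic.isCompact_glFiniteIntegralLevel n F, (∀ π : Literature.NumberTheory.Automorphic.CuspidalAutomorphicRepData n F hcpt, π.1.IsLAlgebraic → ∀ (ℓ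 : ℕ) [Fact ℓ.Prime] (ι : PadicAlgCl ℓ ≃+* ℂ), ∃ ρ : Literature.NumberTheory.GaloisRepresentations.FramedGaloisRep F (PadicAlgCl ℓ) n, Summit.Langlands.IsGeometricFramed Rec ρ ∧ Summit.Langlands.Corresponds Rec ι π.1 ρ) ∧ Summit.Langlands.GaloisToAutomorphic n Rec hcpt) → Summit.Langlands.Langlands.Theses.RamifiedCoefficientSeed.SectorComplement := by
  intro h22 h23 hR
  unfold SectorComplement
  intro _
  exact langlands_of_reciprocityUpToIrreducibilityR_text_of_JS h22 h23 hR

/-! ## §2 Necessity: R is a weakening of the summit, which the crux yields under the target -/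

/-- **R is a weakening of the summit** (drop irreducibility and uniqueness-up-to-conjugacy in clause (A)):
`Langlands` implies the text of item stmt-Langlands-17925, unconditionally. [folklore] -/
theorem reciprocityUpToIrreducibilityR_text_of_langlands (hL : _root_.Langlands) :
    ∀ (F : Type) [Field F] [NumberField F], Nonempty (ReciprocityData F) ∧
      ∀ (Rec : ReciprocityData F) (n : ℕ), 0 < n →
        ∀ hcpt : Literature.NumberTheory.Automorphic.isCompact_glFiniteIntegralLevel n F,
          (∀ π : Literature.NumberTheory.Automorphic.CuspidalAutomorphicRepData n F hcpt, π.1.IsLAlgebraic →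
            ∀ (ℓ : ℕ) [Fact ℓ.Prime] (ι : PadicAlgCl ℓ ≃+* ℂ),
              ∃ ρ : Literature.NumberTheory.GaloisRepresentations.FramedGaloisRep F (PadicAlgCl ℓ) n,
                IsGeometricFramed Rec ρ ∧ Corresponds Rec ι π.1 ρ) ∧ GaloisToAutomorphic n Rec hcpt := by
  intro F _ _
  refine ⟨(hL F).1, fun Rec n hn hcpt ↦ ?_⟩
  obtain ⟨hA, hB⟩ := (hL F).2 Rec n hn hcpt
  refine ⟨fun π hπ ℓ _ ι ↦ ?_, hB⟩
  obtain ⟨ρ, -, hgeo, hcorr, -⟩ := hA π hπ ℓ ι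
  exact ⟨ρ, hgeo, hcorr⟩

/-- **NECESSITY under the route target**: granted `NonPolarisableFamilyAutomorphic`, the crux yields the
summit and hence the text of item stmt-Langlands-17925 — the crux cannot close before that item once the
target holds. [folklore] -/
theorem reciprocityUpToIrreducibilityR_text_of_sectorComplement_of_target
    (hX : NonPolarisableFamilyAutomorphic) (hC : SectorComplement) :
    ∀ (F : Type) [Field F] [NumberField F], Nonempty (ReciprocityData F) ∧
      ∀ (Rec : ReciprocityData F) (n : ℕ), 0 < n →
        ∀ hcpt : Literature.NumberTheory.Automorphic.isCompact_glFiniteIntegralLevel n F,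
          (∀ π : Literature.NumberTheory.Automorphic.CuspidalAutomorphicRepData n F hcpt, π.1.IsLAlgebraic →
            ∀ (ℓ : ℕ) [Fact ℓ.Prime] (ι : PadicAlgCl ℓ ≃+* ℂ),
              ∃ ρ : Literature.NumberTheory.GaloisRepresentations.FramedGaloisRep F (PadicAlgCl ℓ) n,
                IsGeometricFramed Rec ρ ∧ Corresponds Rec ι π.1 ρ) ∧ GaloisToAutomorphic n Rec hcpt :=
  reciprocityUpToIrreducibilityR_text_of_langlands (hC hX)

/-- **NECESSITY under the route's three ranked cruxes** (`ExplicitRamifiedFamily`, `AdjointSeedFromDuality`,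
`AdjointLiftingGL3`): with them the crux yields the summit through the route's own sorry-free deciding
theorem `closes`, hence the text of item stmt-Langlands-17925. [folklore] -/
theorem reciprocityUpToIrreducibilityR_text_of_sectorComplement_of_cruxes
    (h1 : ExplicitRamifiedFamily) (h2 : AdjointSeedFromDuality) (h3 : AdjointLiftingGL3)
    (hC : SectorComplement) :
    ∀ (F : Type) [Field F] [NumberField F], Nonempty (ReciprocityData F) ∧
      ∀ (Rec : ReciprocityData F) (n : ℕ), 0 < n →
        ∀ hcpt : Literature.NumberTheory.Automorphic.isCompact_glFiniteIntegralLevel n F,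
          (∀ π : Literature.NumberTheory.Automorphic.CuspidalAutomorphicRepData n F hcpt, π.1.IsLAlgebraic →
            ∀ (ℓ : ℕ) [Fact ℓ.Prime] (ι : PadicAlgCl ℓ ≃+* ℂ),
              ∃ ρ : Literature.NumberTheory.GaloisRepresentations.FramedGaloisRep F (PadicAlgCl ℓ) n,
                IsGeometricFramed Rec ρ ∧ Corresponds Rec ι π.1 ρ) ∧ GaloisToAutomorphic n Rec hcpt :=
  reciprocityUpToIrreducibilityR_text_of_langlands (closes h1 h2 h3 hC)

/-- **Under JS (2.2)–(2.3) and the route target, the crux is EQUIVALENT to the text of item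
stmt-Langlands-17925** (sufficiency + necessity above): the junction's open content is exactly reciprocity up
to irreducibility for every pinned reciprocity datum.
[cite: BuzzardGeeLMS2014, Conj. 3.2.1 and Conj. 3.2.2] [cite: ArthurClozelAMS120, Ch. 3 §2 (2.2)–(2.3)] -/
theorem sectorComplement_iff_reciprocityUpToIrreducibilityR_text
    (h22 : JacquetShalika1981_partialPairL_boundary_repData)
    (h23 : JacquetShalika1981_partialPairL_pole_repData) (hX : NonPolarisableFamilyAutomorphic) :
    SectorComplement ↔
      ∀ (F : Type) [Field F] [NumberField F], Nonempty (ReciprocityData F) ∧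
        ∀ (Rec : ReciprocityData F) (n : ℕ), 0 < n →
          ∀ hcpt : Literature.NumberTheory.Automorphic.isCompact_glFiniteIntegralLevel n F,
            (∀ π : Literature.NumberTheory.Automorphic.CuspidalAutomorphicRepData n F hcpt, π.1.IsLAlgebraic →
              ∀ (ℓ : ℕ) [Fact ℓ.Prime] (ι : PadicAlgCl ℓ ≃+* ℂ),
                ∃ ρ : Literature.NumberTheory.GaloisRepresentations.FramedGaloisRep F (PadicAlgCl ℓ) n,
                  IsGeometricFramed Rec ρ ∧ Corresponds Rec ι π.1 ρ) ∧ GaloisToAutomorphic n Rec hcpt :=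
  ⟨reciprocityUpToIrreducibilityR_text_of_sectorComplement_of_target hX,
    sectorComplement_of_reciprocityUpToIrreducibilityR_text_of_JS h22 h23⟩

/-! ## §3 Logical position of the crux (summit-equivalence modulo the target / the cruxes) -/

/-- Under the route TARGET the crux is literally the summit: `SectorComplement ↔ Langlands`. [folklore] -/
theorem sectorComplement_iff_langlands_of_target (hX : NonPolarisableFamilyAutomorphic) :
    SectorComplement ↔ _root_.Langlands :=
  ⟨fun hC ↦ hC hX, fun h _ ↦ h⟩

/-- Under the route's three ranked CRUXES the crux is the summit (`→` is the route's sorry-free `closes`).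
[folklore] -/
theorem sectorComplement_iff_langlands_of_cruxes (h1 : ExplicitRamifiedFamily) (h2 : AdjointSeedFromDuality)
    (h3 : AdjointLiftingGL3) : SectorComplement ↔ _root_.Langlands :=
  ⟨fun hC ↦ closes h1 h2 h3 hC, fun h _ ↦ h⟩

/-- Exact content of a refutation of the crux: PROVE the open sector target AND disprove the audited formal
summit — `¬ SectorComplement ↔ NonPolarisableFamilyAutomorphic ∧ ¬ Langlands`. [folklore] -/
theorem not_sectorComplement_iff :
    ¬ SectorComplement ↔ NonPolarisableFamilyAutomorphic ∧ ¬ _root_.Langlands :=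
  Classical.not_imp

-- `¬ SectorComplement → ¬ _root_.Langlands` is not restated: it is the homonymous lemma of the sibling frame
-- `Theorems/SkinnerWilesDefectOneSectorComplement.lean` up to the route namespace (`mt` of `fun h _ ↦ h`).

/-- Truth table of the crux: `SectorComplement ↔ ¬ NonPolarisableFamilyAutomorphic ∨ Langlands`.
[folklore] -/
theorem sectorComplement_iff_not_or :
    SectorComplement ↔ ¬ NonPolarisableFamilyAutomorphic ∨ _root_.Langlands :=
  imp_iff_not_or

/-- Direction (B) of the summit at `n = 3`, `F = ℚ`, in the WEAK (a.e.-Satake) form, for a `ρ` that is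
unramified a.e., de Rham above `p` for Fontaine's pinned datum, and residually absolutely irreducible over
`ℚ(ζ_p)`: for ANY reciprocity data `𝓡` (one exists by the `Nonempty` conjunct) `ρ` is irreducible (residual
absolute irreducibility ⇒ absolute irreducibility of `ρ|ℚ(ζ_p)` ⇒ of `ρ` ⇒ irreducibility) and `𝓡`-geometric
(`𝓡.pst p v hv` is BY DEFINITION `fontainePstAdicCompletion v p hv`), and the Satake clause of `Corresponds`
is the conclusion.  (Re-derivation of `rcs_weakB_rank3_of_langlands`, cstrat q1.)
[cite: DarmonDiamondTaylor1995, §2.1] -/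
theorem weakB_rank3_of_langlands (hL : _root_.Langlands) (p : ℕ) [Fact p.Prime]
    (ρ : FramedGaloisRep ℚ (PadicAlgCl p) 3)
    (hunr : ∀ᶠ v : HeightOneSpectrum (𝓞 ℚ) in cofinite, ρ.IsUnramifiedAt v)
    (hdR : ∀ (v : HeightOneSpectrum (𝓞 ℚ)) (hv : ((p : ℕ) : 𝓞 ℚ) ∈ v.asIdeal),
      (Literature.NumberTheory.PAdicHodge.fontainePstAdicCompletion v p hv).IsDeRhamFramed (ρ.toLocal v))
    (hirr : (ρ.restrictField (CyclotomicField p ℚ)).IsResiduallyAbsIrreducible)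
    (ι : PadicAlgCl p ≃+* ℂ) (hcpt : isCompact_glFiniteIntegralLevel 3 ℚ) :
    ∃ π : CuspidalAutomorphicRepData 3 ℚ hcpt, π.1.IsLAlgebraic ∧
      ∀ᶠ v : HeightOneSpectrum (𝓞 ℚ) in cofinite, SatakeFrobCompatibleAt ι π.1 ρ v := by
  obtain ⟨⟨𝓡⟩, hGL⟩ := hL ℚ
  have hB := (hGL 𝓡 3 (by norm_num) hcpt).2
  have habs : FramedRep.IsAbsolutelyIrreducible ρ :=
    FramedGaloisRep.IsAbsolutelyIrreducible.of_restrictField (CyclotomicField p ℚ) ρ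
      (FramedGaloisRep.IsResiduallyAbsIrreducible.isAbsolutelyIrreducible three_pos hirr)
  have hirr' : ρ.toGaloisRep.IsIrreducible :=
    (FramedRep.isIrreducible_toContinuousRep_iff ρ).2 habs.isIrreducible
  have hgeom : IsGeometricFramed 𝓡 ρ := ⟨hunr, fun v hv => hdR v hv⟩
  obtain ⟨π, hLalg, hcorr⟩ := hB p ι ρ hirr' hgeom
  exact ⟨π, hLalg, hcorr.1⟩

/-- Modulo the summit, the target is the EXISTENCE content of the explicit-family crux: from
`ExplicitRamifiedFamily` (which supplies `p`, `f`, twist-inequivalence, non-self-duality and, member-wise,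
a.e.-unramified + crystalline + residually absolutely irreducible; its residual-duality and conjugation
clauses are not used) and `Langlands` one gets `NonPolarisableFamilyAutomorphic`.  `Langlands → X` without
the family is not formal (X asserts that a family EXISTS).  (Re-derivation of
`rcs_target_of_family_of_langlands`, cstrat q1.) [folklore] -/
theorem target_of_family_of_langlands (h1 : ExplicitRamifiedFamily) (hL : _root_.Langlands) :
    NonPolarisableFamilyAutomorphic := by
  obtain ⟨p, hp, h11, f, hne, hf⟩ := h1
  refine ⟨p, hp, h11, f, hne, fun n => (hf n).1, fun n ι hcpt => ?_⟩
  obtain ⟨_hnsd, hunr, hcrys, _hdual, hirr, _hcc⟩ := hf n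
  exact weakB_rank3_of_langlands hL p (f n) hunr (fun v hv => (hcrys v hv).1.isDeRhamFramed) hirr ι hcpt

/-- Hence, GIVEN the explicit family alone, target-and-crux IS the summit:
`ExplicitRamifiedFamily → (Langlands ↔ NonPolarisableFamilyAutomorphic ∧ SectorComplement)`. [folklore] -/
theorem langlands_iff_target_and_sectorComplement_of_family (h1 : ExplicitRamifiedFamily) :
    _root_.Langlands ↔ NonPolarisableFamilyAutomorphic ∧ SectorComplement :=
  ⟨fun hL ↦ ⟨target_of_family_of_langlands h1 hL, fun _ ↦ hL⟩, fun h ↦ h.2 h.1⟩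

end Summit.Langlands.Langlands.Theorems.RamifiedCoefficientSeedJunctionOfR

end
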